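import Mathlib
import HarnessLib
import Summits.NavierStokesRegularity.NavierStokesRegularity.Theorems.PoloidalWindowDoorLrcModEntireTHCertDictionary

/-!
# Route `PoloidalWindowDoor`, crux `PoloidalWindowRigidity` (stmt-19708) / item `LrcModEntire` (stmt-20428) —
# the local (TH)∩twisting statement MAY ASSUME A GALILEAN REST POINT `u(p₀) = 0`

Seat ns-poloidal-K2-p2 g7 (interim LEAD-of-record on 19708; file `--supports`).  Companion of
`…TwistingTHLocalNonUmbilic` (non-umbilic base point): the second free normalisation of the registered local statement of the
(TH) column (`hemptyHyp` = twist_split v4.1 `stub_localTHEmptyHyp`; CERT-MEMO-4 §0 (a) normal form «unsteady also `u(p₀)=0`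
(Galilean)»).  The local system {`∂₀u₁ = ∂₁u₀`, `div u = 0`, `∂₂u_b = μ(t,z)∂_bu₂`, E} is GALILEAN COVARIANT: for a constant
vector `c` and the shear `τ(t,y) = (t, y + (t−t₀)c)`, the boosted datum
`u′(t,y) = u(τ(t,y)) − c`, `μ′(t,z) = μ(t, z + (t−t₀)c₂)`,
`A′(t,z) = A + c₂(∂ₜμ − ∂_z²μ) + (c₂²/2)∂_zμ` (all at `(t, z + (t−t₀)c₂)`) solves the same system on `U′ = τ⁻¹U`
(`galilean_E` is the one computation: the material derivative is invariant, `Δ` commutes with translations, and the slope's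
time derivative picks up `c₂∂_zμ`), with the same jets at `p₀ = (t₀, x₀)` and `u′(p₀) = u(p₀) − c`.

* `localTHEmptyHypNonUmbilic_of_galilean` — **`hemptyHypNU` ⇐ `hemptyHypNUG`**: the statement with the pins
  `twist(p₀) ≠ 0`, `μ(p₀) ∉ {0,1}`, `∂_zμ(p₀) ≠ 0`, `μ(p₀) < 0`, `Φ₂(p₀) ≠ 0` may ALSO assume `u p₀.1 p₀.2 = 0`
  (choose `c = u(p₀)`).  With `…TwistingTHLocalNonUmbilic.localTHEmptyHyp_of_localTHEmptyHypNonUmbilic` this gives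
  `hemptyHyp` ⇐ `hemptyHypNUG`; in the rest frame the level-1 letter `f₁₀ = (u₀ − iu₁)/2` vanishes, so the finite-type pivot of
  CERT-MEMO-4 (e4) is exactly `f₀₂ ≠ 0` = the non-umbilic pin.

WHAT THIS IS NOT: not a proof of the stub and not a claim about Navier–Stokes regularity — a free normalisation of the registered
local statement (bears_on LADDER-NS N0 via crux 19708 / item 20428).
-/

noncomputable section

-- the summit and its single sub-problem share the name (CONVENTIONS §1), as in every Theorems file
set_option linter.dupNamespace false

namespace Summit.NavierStokesRegularity.NavierStokesRegularity.Theorems.PoloidalWindowDoorLrcModEntireTwistingTHLocalGalilean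

open Set Function Filter Topology Metric
open scoped RealInnerProductSpace InnerProductSpace Laplacian
open Literature.Analysis Literature.Analysis.FluidPDE
open Summit.NavierStokesRegularity.NavierStokesRegularity.Theorems.PoloidalWindowDoorLrcModEntireJetLetters
open Summit.NavierStokesRegularity.NavierStokesRegularity.Theorems.PoloidalWindowDoorLrcModEntireTHCertLetters
open Summit.NavierStokesRegularity.NavierStokesRegularity.Theorems.PoloidalWindowDoorLrcModEntireTHCertDictionary
open Summit.NavierStokesRegularity.NavierStokesRegularity.Theorems.PoloidalWindowDoorPoloidalWindowRigiditySlopeFunctionSource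

variable {u : ℝ → EuclideanSpace ℝ (Fin 3) → EuclideanSpace ℝ (Fin 3)} {μ : ℝ → ℝ → ℝ}
  {U : Set (ℝ × EuclideanSpace ℝ (Fin 3))}

/-! ### The boosted velocity: spatial jets are translated jets -/

/-- The height of a sheared point. [folklore] -/
theorem shear_apply_two (t₀ t : ℝ) (c y : EuclideanSpace ℝ (Fin 3)) :
    (y + (t - t₀) • c) 2 = y 2 + (t - t₀) * c 2 := by
  simp

/-- First spatial derivatives of the boosted field are the translated ones. [folklore] -/
theorem fderiv_boost (u : ℝ → EuclideanSpace ℝ (Fin 3) → EuclideanSpace ℝ (Fin 3)) (t₀ t : ℝ)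
    (c y : EuclideanSpace ℝ (Fin 3)) :
    fderiv ℝ (fun z => u t (z + (t - t₀) • c) - c) y = fderiv ℝ (u t) (y + (t - t₀) • c) :=
  fderiv_comp_add_right_sub_const (u t) ((t - t₀) • c) c y

/-- Second spatial derivatives of the vertical component of the boosted field are the translated ones. [folklore] -/
theorem fderiv_fderiv_boost (u : ℝ → EuclideanSpace ℝ (Fin 3) → EuclideanSpace ℝ (Fin 3)) (t₀ t : ℝ)
    (c y e : EuclideanSpace ℝ (Fin 3)) :
    fderiv ℝ (fun z => fderiv ℝ (fun z' => u t (z' + (t - t₀) • c) - c) z e 2) y =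
      fderiv ℝ (fun z => fderiv ℝ (u t) z e 2) (y + (t - t₀) • c) := by
  have h : (fun z => fderiv ℝ (fun z' => u t (z' + (t - t₀) • c) - c) z e 2) =
      fun z => (fun w => fderiv ℝ (u t) w e 2) (z + (t - t₀) • c) := by
    funext z; rw [fderiv_boost]
  rw [h, fderiv_comp_add_right (f := fun w => fderiv ℝ (u t) w e 2) ((t - t₀) • c)]

/-- The vertical component of the boosted field is a translate of `u₂ − c₂`. [folklore] -/
theorem boost_vert_eq (u : ℝ → EuclideanSpace ℝ (Fin 3) → EuclideanSpace ℝ (Fin 3)) (t₀ t : ℝ)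
    (c : EuclideanSpace ℝ (Fin 3)) :
    (fun z => (u t (z + (t - t₀) • c) - c) 2) = fun z => (fun w => u t w 2 - c 2) (z + (t - t₀) • c) := by
  funext z; simp

/-- The horizontal derivative of the vertical component of the boosted field. [folklore] -/
theorem fderiv_boost_vert (u : ℝ → EuclideanSpace ℝ (Fin 3) → EuclideanSpace ℝ (Fin 3)) (t₀ t : ℝ)
    (c y : EuclideanSpace ℝ (Fin 3)) :
    fderiv ℝ (fun z => (u t (z + (t - t₀) • c) - c) 2) y = fderiv ℝ (fun w => u t w 2) (y + (t - t₀) • c) := by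
  rw [boost_vert_eq, fderiv_comp_add_right (f := fun w => u t w 2 - c 2) ((t - t₀) • c), fderiv_sub_const]

/-- The Laplacian of the vertical component of the boosted field (where the slice is `C²`). [folklore] -/
theorem laplacian_boost_vert (u : ℝ → EuclideanSpace ℝ (Fin 3) → EuclideanSpace ℝ (Fin 3)) (t₀ t : ℝ)
    (c y : EuclideanSpace ℝ (Fin 3)) (h2 : ContDiffAt ℝ 2 (fun w => u t w 2) (y + (t - t₀) • c)) :
    Δ (fun z => (u t (z + (t - t₀) • c) - c) 2) y = Δ (fun w => u t w 2) (y + (t - t₀) • c) := by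
  rw [boost_vert_eq, laplacian_comp_add_right (fun w => u t w 2 - c 2) ((t - t₀) • c) y]
  have e : (fun w => u t w 2 - c 2) = (fun w => u t w 2) - fun _ => c 2 := rfl
  rw [e, h2.laplacian_sub contDiffAt_const]
  simp

/-- The time derivative of the vertical component of the boosted field along a fixed `y`: the material correction `Du₂·c`
appears (chain rule through the analytic space–time field). [folklore] -/
theorem deriv_boost_vert (hu : AnalyticOnNhd ℝ (uncurry u) U) (t₀ : ℝ) (c : EuclideanSpace ℝ (Fin 3)) {t : ℝ}
    {y : EuclideanSpace ℝ (Fin 3)} (hq : ((t, y + (t - t₀) • c) : ℝ × EuclideanSpace ℝ (Fin 3)) ∈ U) :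
    deriv (fun s => (u s (y + (s - t₀) • c) - c) 2) t =
      deriv (fun s => u s (y + (t - t₀) • c) 2) t + fderiv ℝ (fun w => u t w 2) (y + (t - t₀) • c) c := by
  set σ : EuclideanSpace ℝ (Fin 3) := y + (t - t₀) • c with hσ
  have hF : AnalyticAt ℝ (fun q : ℝ × EuclideanSpace ℝ (Fin 3) => u q.1 q.2 2) (t, σ) := analyticOnNhd_comp hu 2 _ hq
  have hγ : HasDerivAt (fun s : ℝ => ((s, y + (s - t₀) • c) : ℝ × EuclideanSpace ℝ (Fin 3))) (((1 : ℝ), c)) t := by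
    have h1 : HasDerivAt (fun s : ℝ => y + (s - t₀) • c) ((1 : ℝ) • c) t :=
      (((hasDerivAt_id t).sub_const t₀).smul_const c).const_add y
    rw [one_smul] at h1
    exact (hasDerivAt_id t).prodMk h1
  have hcomp : HasDerivAt (fun s => (u s (y + (s - t₀) • c) - c) 2)
      (fderiv ℝ (fun q : ℝ × EuclideanSpace ℝ (Fin 3) => u q.1 q.2 2) (t, σ) ((1 : ℝ), c)) t := by
    have h := (hF.differentiableAt.hasFDerivAt.comp_hasDerivAt t (by simpa [hσ] using hγ)).sub_const (c 2)
    refine h.congr_of_eventuallyEq (Eventually.of_forall fun s => ?_)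
    simp
  have hsplit : (((1 : ℝ), c) : ℝ × EuclideanSpace ℝ (Fin 3)) = ((1 : ℝ), (0 : EuclideanSpace ℝ (Fin 3))) + ((0 : ℝ), c) := by
    simp
  have e1 : fderiv ℝ (fun q : ℝ × EuclideanSpace ℝ (Fin 3) => u q.1 q.2 2) (t, σ) ((1 : ℝ), (0 : EuclideanSpace ℝ (Fin 3))) =
      deriv (fun s => u s σ 2) t := (deriv_spacetime_time (p := (t, σ)) hF.differentiableAt).symm
  have e2 : fderiv ℝ (fun q : ℝ × EuclideanSpace ℝ (Fin 3) => u q.1 q.2 2) (t, σ) ((0 : ℝ), c) =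
      fderiv ℝ (fun w => u t w 2) σ c := fderiv_spacetime_spatial (p := (t, σ)) hF.differentiableAt c
  rw [hcomp.deriv, hsplit, map_add, e1, e2]

/-! ### The boosted slope: its jets -/

/-- `∂_z μ′(t,z) = ∂_zμ(t, z + (t−t₀)c₂)`. [folklore] -/
theorem deriv_boostSlope (μ : ℝ → ℝ → ℝ) (t₀ k t z : ℝ) :
    deriv (fun ζ => μ t (ζ + (t - t₀) * k)) z = deriv (μ t) (z + (t - t₀) * k) :=
  deriv_comp_add_const (μ t) ((t - t₀) * k) z

/-- `∂_z² μ′(t,z) = ∂_z²μ(t, z + (t−t₀)c₂)`. [folklore] -/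
theorem deriv_deriv_boostSlope (μ : ℝ → ℝ → ℝ) (t₀ k t z : ℝ) :
    deriv (deriv (fun ζ => μ t (ζ + (t - t₀) * k))) z = deriv (deriv (μ t)) (z + (t - t₀) * k) := by
  have h : deriv (fun ζ => μ t (ζ + (t - t₀) * k)) = fun ζ => deriv (μ t) (ζ + (t - t₀) * k) := by
    funext ζ; exact deriv_boostSlope μ t₀ k t ζ
  rw [h, deriv_comp_add_const (deriv (μ t)) ((t - t₀) * k) z]

/-- `∂ₜ μ′(t,z) = ∂ₜμ + c₂ ∂_zμ` at `(t, z + (t−t₀)c₂)` (chain rule through the analytic slope). [folklore] -/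
theorem deriv_boostSlope_time (μ : ℝ → ℝ → ℝ) (t₀ k : ℝ) {t z : ℝ}
    (hμ : DifferentiableAt ℝ (uncurry μ) (t, z + (t - t₀) * k)) :
    deriv (fun s => μ s (z + (s - t₀) * k)) t =
      deriv (fun s => μ s (z + (t - t₀) * k)) t + k * deriv (μ t) (z + (t - t₀) * k) := by
  set ζ : ℝ := z + (t - t₀) * k with hζ
  have hγ : HasDerivAt (fun s : ℝ => ((s, z + (s - t₀) * k) : ℝ × ℝ)) (((1 : ℝ), k)) t := by
    have h1 : HasDerivAt (fun s : ℝ => z + (s - t₀) * k) ((1 : ℝ) * k) t :=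
      (((hasDerivAt_id t).sub_const t₀).mul_const k).const_add z
    rw [one_mul] at h1
    exact (hasDerivAt_id t).prodMk h1
  have hcomp : HasDerivAt (fun s => μ s (z + (s - t₀) * k)) (fderiv ℝ (uncurry μ) (t, ζ) ((1 : ℝ), k)) t := by
    have h := hμ.hasFDerivAt.comp_hasDerivAt t (by simpa [hζ] using hγ)
    refine h.congr_of_eventuallyEq (Eventually.of_forall fun s => ?_)
    simp
  have hsplit : (((1 : ℝ), k) : ℝ × ℝ) = ((1 : ℝ), (0 : ℝ)) + k • ((0 : ℝ), (1 : ℝ)) := by simp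
  obtain ⟨hz, ht⟩ := hasDerivAt_slices_of_uncurry (p := (t, ζ)) hμ
  rw [hcomp.deriv, hsplit, map_add, map_smul, ← ht.deriv, ← hz.deriv, smul_eq_mul]

/-! ### Galilean covariance of the scalar law E -/

/-- **E is Galilean covariant.**  At a point `(t, y)` whose sheared image `q = (t, y + (t−t₀)c)` lies in `U`, the scalar law E of
the boosted datum `(u′, μ′, A′)` at `(t, y)` IS the law E of `(u, μ, A)` at `q`. [folklore] -/
theorem galilean_E (hu : AnalyticOnNhd ℝ (uncurry u) U) (hμ : ∀ p ∈ U, AnalyticAt ℝ (uncurry μ) (p.1, p.2 2))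
    {A : ℝ → ℝ → ℝ} (t₀ : ℝ) (c : EuclideanSpace ℝ (Fin 3)) {t : ℝ} {y : EuclideanSpace ℝ (Fin 3)}
    (hq : ((t, y + (t - t₀) • c) : ℝ × EuclideanSpace ℝ (Fin 3)) ∈ U)
    (hE : (1 - μ t ((y + (t - t₀) • c) 2)) *
        (deriv (fun s => u s (y + (t - t₀) • c) 2) t +
            fderiv ℝ (fun w => u t w 2) (y + (t - t₀) • c) (u t (y + (t - t₀) • c)) -
          Δ (fun w => u t w 2) (y + (t - t₀) • c)) =
      A t ((y + (t - t₀) • c) 2) +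
          (deriv (fun s => μ s ((y + (t - t₀) • c) 2)) t - deriv (deriv (μ t)) ((y + (t - t₀) • c) 2)) *
            u t (y + (t - t₀) • c) 2 +
        deriv (μ t) ((y + (t - t₀) • c) 2) / 2 * u t (y + (t - t₀) • c) 2 ^ 2 -
      2 * deriv (μ t) ((y + (t - t₀) • c) 2) * fderiv ℝ (u t) (y + (t - t₀) • c) (EuclideanSpace.single 2 1) 2) :
    (1 - μ t (y 2 + (t - t₀) * c 2)) *
        (deriv (fun s => (u s (y + (s - t₀) • c) - c) 2) t +
            fderiv ℝ (fun z => (u t (z + (t - t₀) • c) - c) 2) y (u t (y + (t - t₀) • c) - c) -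
          Δ (fun z => (u t (z + (t - t₀) • c) - c) 2) y) =
      (A t (y 2 + (t - t₀) * c 2) +
            c 2 * (deriv (fun s => μ s (y 2 + (t - t₀) * c 2)) t - deriv (deriv (μ t)) (y 2 + (t - t₀) * c 2)) +
          c 2 ^ 2 / 2 * deriv (μ t) (y 2 + (t - t₀) * c 2)) +
          (deriv (fun s => μ s (y 2 + (s - t₀) * c 2)) t -
              deriv (deriv (fun ζ => μ t (ζ + (t - t₀) * c 2))) (y 2)) *
            (u t (y + (t - t₀) • c) - c) 2 +
        deriv (fun ζ => μ t (ζ + (t - t₀) * c 2)) (y 2) / 2 * (u t (y + (t - t₀) • c) - c) 2 ^ 2 -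
      2 * deriv (fun ζ => μ t (ζ + (t - t₀) * c 2)) (y 2) *
        fderiv ℝ (fun z => u t (z + (t - t₀) • c) - c) y (EuclideanSpace.single 2 1) 2 := by
  set σ : EuclideanSpace ℝ (Fin 3) := y + (t - t₀) • c with hσ
  have hσ2 : σ 2 = y 2 + (t - t₀) * c 2 := by rw [hσ]; simp
  have hF2 : ContDiffAt ℝ 2 (fun w => u t w 2) σ := by
    have h := (analyticOnNhd_comp hu 2 _ hq)
    have h' : AnalyticAt ℝ (fun w => u t w 2) σ := by
      have hc := h.comp (analyticAt_const.prod analyticAt_id : AnalyticAt ℝ (fun w : EuclideanSpace ℝ (Fin 3) =>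
        ((t, w) : ℝ × EuclideanSpace ℝ (Fin 3))) σ)
      simpa [Function.comp_def] using hc
    exact h'.contDiffAt
  have hμd : DifferentiableAt ℝ (uncurry μ) (t, y 2 + (t - t₀) * c 2) := by
    rw [← hσ2]; exact (hμ _ hq).differentiableAt
  rw [deriv_boost_vert hu t₀ c hq, fderiv_boost_vert, laplacian_boost_vert u t₀ t c y hF2, fderiv_boost,
    deriv_boostSlope, deriv_deriv_boostSlope, deriv_boostSlope_time μ t₀ (c 2) hμd, ← hσ2]
  have hlin : fderiv ℝ (fun w => u t w 2) σ (u t σ - c) = fderiv ℝ (fun w => u t w 2) σ (u t σ) -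
      fderiv ℝ (fun w => u t w 2) σ c := map_sub _ _ _
  have hv : (u t σ - c) 2 = u t σ 2 - c 2 := by simp
  rw [hlin, hv]
  linear_combination hE

/-! ### The relocation: `hemptyHypNU` ⇐ `hemptyHypNUG` -/

/-- **The pinned hyperbolic local (TH)∩twisting statement may assume a rest point `u(p₀) = 0`.**  `hemptyHypNUG` is `hemptyHypNU`
(`…TwistingTHLocalNonUmbilic`: `hemptyHyp` + the non-umbilic pin) with ONE MORE hypothesis `u p₀.1 p₀.2 = 0` before `False`;
then `hemptyHypNUG → hemptyHypNU` (boost by `c = u(p₀)`). [folklore] -/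
theorem localTHEmptyHypNonUmbilic_of_galilean
    (hG : ∀ (u : ℝ → EuclideanSpace ℝ (Fin 3) → EuclideanSpace ℝ (Fin 3)) (μ A : ℝ → ℝ → ℝ)
      (U : Set (ℝ × EuclideanSpace ℝ (Fin 3))) (p₀ : ℝ × EuclideanSpace ℝ (Fin 3)),
      IsOpen U → p₀ ∈ U →
      AnalyticOnNhd ℝ (Function.uncurry u) U →
      (∀ p ∈ U, AnalyticAt ℝ (Function.uncurry μ) (p.1, p.2 2)) →
      (∀ p ∈ U, AnalyticAt ℝ (Function.uncurry A) (p.1, p.2 2)) →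
      (∀ p ∈ U, fderiv ℝ (u p.1) p.2 (EuclideanSpace.single 0 1) 1 = fderiv ℝ (u p.1) p.2 (EuclideanSpace.single 1 1) 0) →
      (∀ p ∈ U, fderiv ℝ (u p.1) p.2 (EuclideanSpace.single 0 1) 0 + fderiv ℝ (u p.1) p.2 (EuclideanSpace.single 1 1) 1 +
        fderiv ℝ (u p.1) p.2 (EuclideanSpace.single 2 1) 2 = 0) →
      (∀ p ∈ U, ∀ b : Fin 3, b ≠ 2 →
        fderiv ℝ (u p.1) p.2 (EuclideanSpace.single 2 1) b =
          μ p.1 (p.2 2) * fderiv ℝ (u p.1) p.2 (EuclideanSpace.single b 1) 2) →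
      (∀ p ∈ U,
        (1 - μ p.1 (p.2 2)) *
            (deriv (fun s => u s p.2 2) p.1 + fderiv ℝ (fun y => u p.1 y 2) p.2 (u p.1 p.2)
              - Δ (fun y => u p.1 y 2) p.2) =
          A p.1 (p.2 2) + (deriv (fun s => μ s (p.2 2)) p.1 - deriv (deriv (μ p.1)) (p.2 2)) * u p.1 p.2 2
            + deriv (μ p.1) (p.2 2) / 2 * u p.1 p.2 2 ^ 2
            - 2 * deriv (μ p.1) (p.2 2) * fderiv ℝ (u p.1) p.2 (EuclideanSpace.single 2 1) 2) →
      fderiv ℝ (fun y => fderiv ℝ (u p₀.1) y (EuclideanSpace.single 2 1) 2) p₀.2 (EuclideanSpace.single 0 1) *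
            fderiv ℝ (u p₀.1) p₀.2 (EuclideanSpace.single 1 1) 2 -
          fderiv ℝ (fun y => fderiv ℝ (u p₀.1) y (EuclideanSpace.single 2 1) 2) p₀.2 (EuclideanSpace.single 1 1) *
            fderiv ℝ (u p₀.1) p₀.2 (EuclideanSpace.single 0 1) 2 ≠ 0 →
      μ p₀.1 (p₀.2 2) ≠ 0 → μ p₀.1 (p₀.2 2) ≠ 1 → deriv (μ p₀.1) (p₀.2 2) ≠ 0 →
      μ p₀.1 (p₀.2 2) < 0 →
      (fderiv ℝ (u p₀.1) p₀.2 (EuclideanSpace.single 0 1) 0 ≠ fderiv ℝ (u p₀.1) p₀.2 (EuclideanSpace.single 1 1) 1 ∨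
        fderiv ℝ (u p₀.1) p₀.2 (EuclideanSpace.single 1 1) 0 ≠ 0) →
      u p₀.1 p₀.2 = 0 → False) :
    ∀ (u : ℝ → EuclideanSpace ℝ (Fin 3) → EuclideanSpace ℝ (Fin 3)) (μ A : ℝ → ℝ → ℝ)
      (U : Set (ℝ × EuclideanSpace ℝ (Fin 3))) (p₀ : ℝ × EuclideanSpace ℝ (Fin 3)),
      IsOpen U → p₀ ∈ U →
      AnalyticOnNhd ℝ (Function.uncurry u) U →
      (∀ p ∈ U, AnalyticAt ℝ (Function.uncurry μ) (p.1, p.2 2)) →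
      (∀ p ∈ U, AnalyticAt ℝ (Function.uncurry A) (p.1, p.2 2)) →
      (∀ p ∈ U, fderiv ℝ (u p.1) p.2 (EuclideanSpace.single 0 1) 1 = fderiv ℝ (u p.1) p.2 (EuclideanSpace.single 1 1) 0) →
      (∀ p ∈ U, fderiv ℝ (u p.1) p.2 (EuclideanSpace.single 0 1) 0 + fderiv ℝ (u p.1) p.2 (EuclideanSpace.single 1 1) 1 +
        fderiv ℝ (u p.1) p.2 (EuclideanSpace.single 2 1) 2 = 0) →
      (∀ p ∈ U, ∀ b : Fin 3, b ≠ 2 →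
        fderiv ℝ (u p.1) p.2 (EuclideanSpace.single 2 1) b =
          μ p.1 (p.2 2) * fderiv ℝ (u p.1) p.2 (EuclideanSpace.single b 1) 2) →
      (∀ p ∈ U,
        (1 - μ p.1 (p.2 2)) *
            (deriv (fun s => u s p.2 2) p.1 + fderiv ℝ (fun y => u p.1 y 2) p.2 (u p.1 p.2)
              - Δ (fun y => u p.1 y 2) p.2) =
          A p.1 (p.2 2) + (deriv (fun s => μ s (p.2 2)) p.1 - deriv (deriv (μ p.1)) (p.2 2)) * u p.1 p.2 2
            + deriv (μ p.1) (p.2 2) / 2 * u p.1 p.2 2 ^ 2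
            - 2 * deriv (μ p.1) (p.2 2) * fderiv ℝ (u p.1) p.2 (EuclideanSpace.single 2 1) 2) →
      fderiv ℝ (fun y => fderiv ℝ (u p₀.1) y (EuclideanSpace.single 2 1) 2) p₀.2 (EuclideanSpace.single 0 1) *
            fderiv ℝ (u p₀.1) p₀.2 (EuclideanSpace.single 1 1) 2 -
          fderiv ℝ (fun y => fderiv ℝ (u p₀.1) y (EuclideanSpace.single 2 1) 2) p₀.2 (EuclideanSpace.single 1 1) *
            fderiv ℝ (u p₀.1) p₀.2 (EuclideanSpace.single 0 1) 2 ≠ 0 →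
      μ p₀.1 (p₀.2 2) ≠ 0 → μ p₀.1 (p₀.2 2) ≠ 1 → deriv (μ p₀.1) (p₀.2 2) ≠ 0 →
      μ p₀.1 (p₀.2 2) < 0 →
      (fderiv ℝ (u p₀.1) p₀.2 (EuclideanSpace.single 0 1) 0 ≠ fderiv ℝ (u p₀.1) p₀.2 (EuclideanSpace.single 1 1) 1 ∨
        fderiv ℝ (u p₀.1) p₀.2 (EuclideanSpace.single 1 1) 0 ≠ 0) → False := by
  intro u μ A U p₀ hU hp₀ hu hμ hA hpol hdiv hsh hE htw hm0 hm1 hmz hneg hNU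
  obtain ⟨t₀, x₀⟩ := p₀
  set c : EuclideanSpace ℝ (Fin 3) := u t₀ x₀ with hc
  -- the shear and the boosted datum
  set τ : ℝ × EuclideanSpace ℝ (Fin 3) → ℝ × EuclideanSpace ℝ (Fin 3) := fun p => (p.1, p.2 + (p.1 - t₀) • c) with hτ
  set u' : ℝ → EuclideanSpace ℝ (Fin 3) → EuclideanSpace ℝ (Fin 3) := fun s z => u s (z + (s - t₀) • c) - c with hu'
  set μ' : ℝ → ℝ → ℝ := fun s ζ => μ s (ζ + (s - t₀) * c 2) with hμ'
  set A' : ℝ → ℝ → ℝ := fun s ζ => A s (ζ + (s - t₀) * c 2) +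
      c 2 * (jetLetter (uncurry μ) (word2 1 0) (s, ζ + (s - t₀) * c 2) -
        jetLetter (uncurry μ) (word2 0 2) (s, ζ + (s - t₀) * c 2)) +
      c 2 ^ 2 / 2 * jetLetter (uncurry μ) (word2 0 1) (s, ζ + (s - t₀) * c 2) with hA'
  set U' : Set (ℝ × EuclideanSpace ℝ (Fin 3)) := τ ⁻¹' U with hU'
  have hτc : Continuous τ := by rw [hτ]; fun_prop
  have hτa : ∀ p, AnalyticAt ℝ τ p := fun p => by
    rw [hτ]
    exact analyticAt_fst.prod (analyticAt_snd.add ((analyticAt_fst.sub analyticAt_const).smul analyticAt_const))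
  have hτ2 : ∀ p : ℝ × EuclideanSpace ℝ (Fin 3), ((τ p).1, (τ p).2 2) = (p.1, p.2 2 + (p.1 - t₀) * c 2) := fun p => by
    rw [hτ]; simp
  -- the shear on shadows
  have hsha : ∀ q : ℝ × ℝ, AnalyticAt ℝ (fun q : ℝ × ℝ => ((q.1, q.2 + (q.1 - t₀) * c 2) : ℝ × ℝ)) q := fun q =>
    analyticAt_fst.prod (analyticAt_snd.add ((analyticAt_fst.sub analyticAt_const).mul analyticAt_const))
  have hU'o : IsOpen U' := hU.preimage hτc
  have hτ₀ : τ (t₀, x₀) = (t₀, x₀) := by rw [hτ]; simp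
  have hp₀' : ((t₀, x₀) : ℝ × EuclideanSpace ℝ (Fin 3)) ∈ U' := by
    show τ (t₀, x₀) ∈ U; rw [hτ₀]; exact hp₀
  -- analyticity of the boosted datum
  have hu'a : AnalyticOnNhd ℝ (uncurry u') U' := by
    intro p hp
    have h := ((hu (τ p) hp).comp (hτa p)).sub (analyticAt_const (v := c))
    refine h.congr (Eventually.of_forall fun q => ?_)
    obtain ⟨s, z⟩ := q; rfl
  have hμ'a : ∀ p ∈ U', AnalyticAt ℝ (uncurry μ') (p.1, p.2 2) := by
    intro p hp
    have h1 : AnalyticAt ℝ (uncurry μ) (p.1, p.2 2 + (p.1 - t₀) * c 2) := by rw [← hτ2]; exact hμ (τ p) hp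
    have h := AnalyticAt.comp (f := fun q : ℝ × ℝ => ((q.1, q.2 + (q.1 - t₀) * c 2) : ℝ × ℝ)) (x := (p.1, p.2 2))
      h1 (hsha (p.1, p.2 2))
    refine h.congr (Eventually.of_forall fun q => ?_)
    obtain ⟨s, ζ⟩ := q; rfl
  have hA'a : ∀ p ∈ U', AnalyticAt ℝ (uncurry A') (p.1, p.2 2) := by
    intro p hp
    have hm : ((p.1, p.2 2 + (p.1 - t₀) * c 2) : ℝ × ℝ) ∈ analyticSet μ := by
      show AnalyticAt ℝ (uncurry μ) _; rw [← hτ2]; exact hμ (τ p) hp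
    have hJ : ∀ w, AnalyticAt ℝ (fun q : ℝ × ℝ => jetLetter (uncurry μ) w (q.1, q.2 + (q.1 - t₀) * c 2)) (p.1, p.2 2) :=
      fun w => AnalyticAt.comp (f := fun q : ℝ × ℝ => ((q.1, q.2 + (q.1 - t₀) * c 2) : ℝ × ℝ)) (x := (p.1, p.2 2))
        (analyticOnNhd_jetLetter (analyticOnNhd_analyticSet μ) w _ hm) (hsha (p.1, p.2 2))
    have hA1 : AnalyticAt ℝ (fun q : ℝ × ℝ => A q.1 (q.2 + (q.1 - t₀) * c 2)) (p.1, p.2 2) := by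
      have h1 : AnalyticAt ℝ (uncurry A) (p.1, p.2 2 + (p.1 - t₀) * c 2) := by rw [← hτ2]; exact hA (τ p) hp
      have h := AnalyticAt.comp (f := fun q : ℝ × ℝ => ((q.1, q.2 + (q.1 - t₀) * c 2) : ℝ × ℝ)) (x := (p.1, p.2 2))
        h1 (hsha (p.1, p.2 2))
      refine h.congr (Eventually.of_forall fun q => ?_)
      obtain ⟨s, ζ⟩ := q; rfl
    have h := (hA1.add ((analyticAt_const (v := c 2)).mul ((hJ (word2 1 0)).sub (hJ (word2 0 2))))).add
      ((analyticAt_const (v := c 2 ^ 2 / 2)).mul (hJ (word2 0 1)))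
    refine h.congr (Eventually.of_forall fun q => ?_)
    obtain ⟨s, ζ⟩ := q; rfl
  -- the kinematic identities transfer pointwise through the translated jets
  have hent : ∀ p : ℝ × EuclideanSpace ℝ (Fin 3), ∀ e : EuclideanSpace ℝ (Fin 3), ∀ i : Fin 3,
      fderiv ℝ (u' p.1) p.2 e i = fderiv ℝ (u (τ p).1) (τ p).2 e i := fun p e i => by
    rw [hu', hτ]; dsimp only; rw [fderiv_boost]
  have hslope : ∀ p : ℝ × EuclideanSpace ℝ (Fin 3), μ' p.1 (p.2 2) = μ (τ p).1 ((τ p).2 2) := fun p => by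
    rw [hμ', hτ]; simp
  have hpol' : ∀ p ∈ U', fderiv ℝ (u' p.1) p.2 (EuclideanSpace.single 0 1) 1 =
      fderiv ℝ (u' p.1) p.2 (EuclideanSpace.single 1 1) 0 := fun p hp => by
    rw [hent, hent]; exact hpol (τ p) hp
  have hdiv' : ∀ p ∈ U', fderiv ℝ (u' p.1) p.2 (EuclideanSpace.single 0 1) 0 +
      fderiv ℝ (u' p.1) p.2 (EuclideanSpace.single 1 1) 1 + fderiv ℝ (u' p.1) p.2 (EuclideanSpace.single 2 1) 2 = 0 :=
    fun p hp => by rw [hent, hent, hent]; exact hdiv (τ p) hp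
  have hsh' : ∀ p ∈ U', ∀ b : Fin 3, b ≠ 2 → fderiv ℝ (u' p.1) p.2 (EuclideanSpace.single 2 1) b =
      μ' p.1 (p.2 2) * fderiv ℝ (u' p.1) p.2 (EuclideanSpace.single b 1) 2 := fun p hp b hb => by
    rw [hent, hent, hslope]; exact hsh (τ p) hp b hb
  -- the scalar law transfers by Galilean covariance
  have hE' : ∀ p ∈ U',
      (1 - μ' p.1 (p.2 2)) *
          (deriv (fun s => u' s p.2 2) p.1 + fderiv ℝ (fun y => u' p.1 y 2) p.2 (u' p.1 p.2)
            - Δ (fun y => u' p.1 y 2) p.2) =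
        A' p.1 (p.2 2) + (deriv (fun s => μ' s (p.2 2)) p.1 - deriv (deriv (μ' p.1)) (p.2 2)) * u' p.1 p.2 2
          + deriv (μ' p.1) (p.2 2) / 2 * u' p.1 p.2 2 ^ 2
          - 2 * deriv (μ' p.1) (p.2 2) * fderiv ℝ (u' p.1) p.2 (EuclideanSpace.single 2 1) 2 := by
    intro p hp
    obtain ⟨t, y⟩ := p
    have hq : ((t, y + (t - t₀) • c) : ℝ × EuclideanSpace ℝ (Fin 3)) ∈ U := hp
    have hEq := hE _ hq
    dsimp only at hEq
    have h10 := letterFn_M10 (u := u) (A := A) hμ hq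
    have h01 := letterFn_M01 (u := u) (A := A) hμ hq
    have h02 := letterFn_M02 (u := u) (A := A) hμ hq
    simp only [letterFn, shear_apply_two] at h10 h01 h02
    have hG := galilean_E (A := A) hu hμ t₀ c hq hEq
    rw [hu', hμ', hA']
    dsimp only
    rw [h10, h01, h02]
    exact hG
  -- the pins at `p₀` are unchanged and `u′(p₀) = 0`
  have hent₀ : ∀ e : EuclideanSpace ℝ (Fin 3), ∀ i : Fin 3, fderiv ℝ (u' t₀) x₀ e i = fderiv ℝ (u t₀) x₀ e i :=
    fun e i => by have h := hent (t₀, x₀) e i; rwa [hτ₀] at h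
  have hent2₀ : ∀ e : EuclideanSpace ℝ (Fin 3),
      fderiv ℝ (fun y => fderiv ℝ (u' t₀) y (EuclideanSpace.single 2 1) 2) x₀ e =
        fderiv ℝ (fun y => fderiv ℝ (u t₀) y (EuclideanSpace.single 2 1) 2) x₀ e := fun e => by
    rw [hu']; dsimp only; rw [fderiv_fderiv_boost]; simp
  have hsl₀ : μ' t₀ (x₀ 2) = μ t₀ (x₀ 2) := by rw [hμ']; simp
  have hslz₀ : deriv (μ' t₀) (x₀ 2) = deriv (μ t₀) (x₀ 2) := by
    rw [hμ']; dsimp only; rw [deriv_boostSlope]; simp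
  have hrest : u' t₀ x₀ = 0 := by rw [hu']; simp [hc]
  refine hG u' μ' A' U' (t₀, x₀) hU'o hp₀' hu'a hμ'a hA'a hpol' hdiv' hsh' hE' ?_ ?_ ?_ ?_ ?_ ?_ hrest
  · simp only [hent₀, hent2₀]; exact htw
  · simp only [hsl₀]; exact hm0
  · simp only [hsl₀]; exact hm1
  · simp only [hslz₀]; exact hmz
  · simp only [hsl₀]; exact hneg
  · simp only [hent₀]; exact hNU

end Summit.NavierStokesRegularity.NavierStokesRegularity.Theorems.PoloidalWindowDoorLrcModEntireTwistingTHLocalGalilean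

end
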